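import Summits.HubbardSuperconductivity.HubbardSuperconductivity.Theorems.WidthHaldaneTubeEtaPairing
import Summits.HubbardSuperconductivity.HubbardSuperconductivity.Theorems.WidthHaldaneEtaLowestWeight

/-!
# The column `d_{x²-y²}` pair field of the even tube is the top of an exact `η`-pseudospin triplet

Support file for crux `WidthHaldaneBridge` (stmt-HubbardSuperconductivity-16311; routes
`WidthHaldane`, `SeamInduction`), line `IdeaSketchK2`, card `eta-lowest-weight`: it PROVES the
registered stub `stub_columnPairTriplet` (the last declaration of this file, same statement). With
`η = etaLower ε = Σ_z ε_z c_{z↓} c_{z↑}` (Yang's lowering operator, `η† = etaRaise ε`), the explicit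
bipartite stagger `ε = (-1)^{a+b}` of the tube `ℤ/L × ℤ/M` (`L`, `M` even) and the column pair field
`Φ_a = Σ_b P_{e⁻¹(a,b)}` (`P_x = tubeDWavePair`, the `d_{x²-y²}` singlet pair ANNIHILATOR of
`Theorems/WidthHaldaneDefs`):

  `[η, [η, Φ_a†]] = 2 Φ_a`  and  `[η†, Φ_a†] = 0`,

i.e. `(Φ_a†, [η, Φ_a†], Φ_a)` is an exact pseudospin triplet (pure CAR algebra, no Hamiltonian).

Bond by bond (`s_{xy} = c_{x↑}c_{y↓} - c_{x↓}c_{y↑}` the singlet annihilator of a bond `x ≠ y` with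
`ε_y = -ε_x`, `s†_{xy} = c†_{y↓}c†_{x↑} - c†_{y↑}c†_{x↓}`):

* `annPair_commutator_crePair` — `[c_a c_b, c†_p c†_q]` for `b ≠ p`, `a ≠ q` (CAR bookkeeping);
  `crePair_mul_crePair_comm` — pair creators commute;
* `etaLower_commutator_bondCreation` — `[η, s†_{xy}] = ε_x Σ_σ (c†_{yσ}c_{xσ} - c†_{xσ}c_{yσ})`
  (a staggered bond current);
* `etaLower_commutator_seamPair` — `[η, Σ_σ (α c†_{xσ}c_{yσ} + β c†_{yσ}c_{xσ})] = (β - α) ε_x s_{xy}`,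
  the conjugate transpose of the landed `seamPair_commutator_etaRaise`;
* `bond_etaTriplet` — hence `[η, [η, s†_{xy}]] = 2 ε_x² s_{xy} = 2 s_{xy}` and `[η†, s†_{xy}] = 0`;
* `bondSum_etaTriplet`, `tubeDWavePair_etaTriplet` — linear extension to real combinations of bond
  singlets, in particular to `P_x` (its four neighbours have the opposite stagger:
  `stagger_nbr_flip`, from `val_add_one_mod_two`), and `stub_columnPairTriplet` — to the column sum.

References: C. N. Yang, PRL 63 (1989) 2144, eqs. (4)–(6); C. N. Yang, S. C. Zhang, Mod. Phys. Lett.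
B 4 (1990) 759, Theorem 1; S.-C. Zhang, PRL 65 (1990) 120 (pseudospin multiplets of pair operators);
F. H. L. Essler et al., *The One-Dimensional Hubbard Model* (2005) §2.1–§2.2 (CAR, commutators of
fermion bilinears); D. J. Scalapino, Phys. Rep. 250 (1995) 329, §2 (the `d_{x²-y²}` pair field).
-/

noncomputable section

namespace Summit.HubbardSuperconductivity.HubbardSuperconductivity.Theorems.WidthHaldane

set_option linter.dupNamespace false -- summit = problem name (single-conjunct summit), D-0017

open scoped BigOperators Classical Matrix ComplexConjugate
open Matrix Literature.MathematicalPhysics.QuantumLattice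

/-! ### CAR bookkeeping: a pair annihilator against a pair creator -/

section CAR

variable {ι : Type*} [LinearOrder ι] [Fintype ι]

/-- `[c_a c_b, c†_p c†_q] = δ_{ap} c†_q c_b + δ_{bq} c†_p c_a - δ_{ap} δ_{bq}` when `b ≠ p` and `a ≠ q`
(from the CAR `c_i c†_j = δ_{ij} - c†_j c_i`; the orientation met by `η = Σ_z ε_z c_{z↓} c_{z↑}`
against a singlet bond creator). Essler et al. (2005) §2.2, eq. (2.72); cf. the tree's
`hop_pair_commutator`. [cite: EsslerEtAl2005, §2.2 eq. (2.72)] -/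
theorem annPair_commutator_crePair {a b p q : ι} (hbp : b ≠ p) (haq : a ≠ q) :
    annihilation a * annihilation b * (creation p * creation q) -
        creation p * creation q * (annihilation a * annihilation b) =
      (if a = p then creation q * annihilation b else 0) +
        (if b = q then creation p * annihilation a else 0) -
        (if a = p then (if b = q then (1 : Matrix (Finset ι) (Finset ι) ℂ) else 0) else 0) := by
  have h1 : annihilation a * annihilation b * (creation p * creation q) =
      -(((if a = p then (1 : Matrix (Finset ι) (Finset ι) ℂ) else 0) - creation p * annihilation a) *
        ((if b = q then (1 : Matrix (Finset ι) (Finset ι) ℂ) else 0) -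
          creation q * annihilation b)) := by
    rw [← annihilation_mul_creation a p, ← annihilation_mul_creation b q]
    calc annihilation a * annihilation b * (creation p * creation q)
        = annihilation a * (annihilation b * creation p) * creation q := by simp only [mul_assoc]
      _ = _ := by
        rw [annihilation_mul_creation b p, if_neg hbp, zero_sub]
        simp only [mul_neg, neg_mul, mul_assoc]
  have h2 : creation p * annihilation a * (creation q * annihilation b) =
      -(creation p * creation q * (annihilation a * annihilation b)) := by
    calc creation p * annihilation a * (creation q * annihilation b)
        = creation p * (annihilation a * creation q) * annihilation b := by simp only [mul_assoc]
      _ = _ := by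
        rw [annihilation_mul_creation a q, if_neg haq, zero_sub]
        simp only [mul_neg, neg_mul, mul_assoc]
  rw [h1]
  split_ifs with hap hbq
  · simp only [mul_sub, sub_mul, one_mul, mul_one, h2]
    abel
  · simp only [mul_sub, sub_mul, mul_zero, one_mul, h2]
    abel
  · simp only [mul_sub, sub_mul, zero_mul, mul_one, h2]
    abel
  · simp only [mul_sub, sub_mul, zero_mul, mul_zero, h2]
    abel

/-- Two pair creators commute: `c†_a c†_b · c†_p c†_q = c†_p c†_q · c†_a c†_b` (four anticommutations,
`creation_mul_creation_eq_neg`). Essler et al. (2005) §2.1, eq. (2.2a). [folklore] -/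
theorem crePair_mul_crePair_comm (a b p q : ι) :
    creation a * creation b * (creation p * creation q) =
      creation p * creation q * (creation a * creation b) := by
  have h3 : ∀ i : ι, creation i * creation p * creation q = creation p * creation q * creation i := by
    intro i
    rw [creation_mul_creation_eq_neg i p, neg_mul, mul_assoc, creation_mul_creation_eq_neg i q,
      mul_neg, neg_neg, mul_assoc]
  calc creation a * creation b * (creation p * creation q)
      = creation a * (creation b * creation p * creation q) := by simp only [mul_assoc]
    _ = creation a * creation p * creation q * creation b := by rw [h3 b]; simp only [mul_assoc]
    _ = _ := by rw [h3 a]; simp only [mul_assoc]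

end CAR

/-! ### One bond: the singlet creator, the staggered current, the singlet annihilator -/

section Bond

variable {Λ : Type*} [LinearOrder Λ] [Fintype Λ]

omit [LinearOrder Λ] [Fintype Λ] in
/-- Sites of opposite stagger are distinct (`u ≠ -u` in `ℤˣ`). [folklore] -/
theorem ne_of_sign_eq_neg (ε : Λ → ℤˣ) {x y : Λ} (hxy : ε x = -ε y) : x ≠ y := by
  rintro rfl
  rcases Int.units_eq_one_or (ε x) with h | h <;> rw [h] at hxy <;> simp at hxy

/-- **`[η, s†_{xy}]` is a staggered bond current.** For `ε_x = -ε_y` and the bond singlet creator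
`s†_{xy} = c†_{y↓}c†_{x↑} - c†_{y↑}c†_{x↓}` (the conjugate transpose of
`s_{xy} = c_{x↑}c_{y↓} - c_{x↓}c_{y↑}`):
`η s† - s† η = ε_x Σ_σ (-c†_{xσ}c_{yσ} + c†_{yσ}c_{xσ})`, `η = Σ_z ε_z c_{z↓}c_{z↑}` (only `z ∈ {x, y}`
contribute). Yang, PRL 63 (1989) 2144, eqs. (4)–(5); S.-C. Zhang, PRL 65 (1990) 120.
[cite: Yang1989, eqs. (4)–(5)] -/
theorem etaLower_commutator_bondCreation (ε : Λ → ℤˣ) {x y : Λ} (hxy : ε x = -ε y) :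
    etaLower ε * (creation (orb y 1) * creation (orb x 0) - creation (orb y 0) * creation (orb x 1)) -
        (creation (orb y 1) * creation (orb x 0) - creation (orb y 0) * creation (orb x 1)) *
          etaLower ε =
      ((ε x : ℤ) : ℂ) • ∑ σ : Fin 2, ((-1 : ℂ) • (creation (orb x σ) * annihilation (orb y σ)) +
        (1 : ℂ) • (creation (orb y σ) * annihilation (orb x σ))) := by
  have hne : x ≠ y := ne_of_sign_eq_neg ε hxy
  have hne' : y ≠ x := hne.symm
  have hy : ((ε y : ℤ) : ℂ) = -((ε x : ℤ) : ℂ) := by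
    rw [hxy, Units.val_neg, Int.cast_neg, neg_neg]
  have h10 : (1 : Fin 2) ≠ 0 := by decide
  -- reorient the second creator so that `annPair_commutator_crePair` applies to both
  have hB : ∀ z : Λ, annihilation (orb z 1) * annihilation (orb z 0) *
        (creation (orb y 0) * creation (orb x 1)) -
      creation (orb y 0) * creation (orb x 1) * (annihilation (orb z 1) * annihilation (orb z 0)) =
      -(annihilation (orb z 1) * annihilation (orb z 0) * (creation (orb x 1) * creation (orb y 0)) -
        creation (orb x 1) * creation (orb y 0) * (annihilation (orb z 1) * annihilation (orb z 0))) := by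
    intro z
    rw [creation_mul_creation_eq_neg (orb y 0) (orb x 1)]
    simp only [mul_neg, neg_mul, neg_sub_neg, neg_sub]
  have hterm : ∀ z : Λ,
      annihilation (orb z 1) * annihilation (orb z 0) *
            (creation (orb y 1) * creation (orb x 0) - creation (orb y 0) * creation (orb x 1)) -
          (creation (orb y 1) * creation (orb x 0) - creation (orb y 0) * creation (orb x 1)) *
            (annihilation (orb z 1) * annihilation (orb z 0)) =
        ((if z = y then creation (orb x 0) * annihilation (orb z 0) else 0) +
            (if z = x then creation (orb y 1) * annihilation (orb z 1) else 0) -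
            (if z = y then (if z = x then (1 : Matrix _ _ ℂ) else 0) else 0)) +
          ((if z = x then creation (orb y 0) * annihilation (orb z 0) else 0) +
            (if z = y then creation (orb x 1) * annihilation (orb z 1) else 0) -
            (if z = x then (if z = y then (1 : Matrix _ _ ℂ) else 0) else 0)) := by
    intro z
    rw [mul_sub, sub_mul, sub_sub_sub_comm, hB z, sub_neg_eq_add,
      annPair_commutator_crePair (fun h => h10.symm (orb_eq_orb_iff.1 h).2)
        (fun h => h10 (orb_eq_orb_iff.1 h).2),
      annPair_commutator_crePair (fun h => h10.symm (orb_eq_orb_iff.1 h).2)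
        (fun h => h10 (orb_eq_orb_iff.1 h).2)]
    simp only [orb_eq_orb_iff, and_true]
  rw [etaLower_eq_sum_holds ε, Finset.sum_mul, Finset.mul_sum, ← Finset.sum_sub_distrib]
  simp only [smul_mul_assoc, mul_smul_comm, ← smul_sub, hterm]
  simp only [smul_add, smul_sub, smul_ite, smul_zero, Finset.sum_add_distrib,
    Finset.sum_sub_distrib, Finset.sum_ite_eq', Finset.mem_univ, if_true, hne, hne', if_false,
    Fin.sum_univ_two, Fin.isValue]
  rw [hy]
  module

/-- **`[η, bond current] = singlet annihilator`**: for `ε_x = -ε_y` and amplitudes `α`, `β`,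
`[η, Σ_σ (α c†_{xσ}c_{yσ} + β c†_{yσ}c_{xσ})] = (β - α) ε_x (c_{x↑}c_{y↓} - c_{x↓}c_{y↑})` — the
conjugate transpose of `seamPair_commutator_etaRaise` (with `x ↔ y` and `(α, β) ↦ (ᾱ, β̄)`).
Yang, PRL 63 (1989) 2144, eq. (6); Essler et al. (2005) §2.2.5, eq. (2.84). [cite: Yang1989, eq. (6)] -/
theorem etaLower_commutator_seamPair (ε : Λ → ℤˣ) {x y : Λ} (hxy : ε x = -ε y) (α β : ℂ) :
    etaLower ε * (∑ σ : Fin 2, (α • (creation (orb x σ) * annihilation (orb y σ)) +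
        β • (creation (orb y σ) * annihilation (orb x σ)))) -
      (∑ σ : Fin 2, (α • (creation (orb x σ) * annihilation (orb y σ)) +
        β • (creation (orb y σ) * annihilation (orb x σ)))) * etaLower ε =
      ((β - α) * ((ε x : ℤ) : ℂ)) •
        (annihilation (orb x 0) * annihilation (orb y 1) -
          annihilation (orb x 1) * annihilation (orb y 0)) := by
  have hyx : ε y = -ε x := by rw [hxy, neg_neg]
  have h := congr_arg conjTranspose (seamPair_commutator_etaRaise ε hyx (star α) (star β))
  simp only [conjTranspose_sub, conjTranspose_mul, conjTranspose_sum, conjTranspose_add,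
    conjTranspose_smul, creation_conjTranspose, annihilation_conjTranspose, star_star, star_mul',
    star_sub, star_intCast] at h
  rw [show (etaRaise ε)ᴴ = etaLower ε from rfl] at h
  rw [h, ← neg_sub (annihilation (orb x 0) * annihilation (orb y 1)), smul_neg, ← neg_smul]
  congr 1
  ring

/-- **The bond singlet is the top of an `η`-triplet.** For `ε_x = -ε_y`:
`[η, [η, s†_{xy}]] = 2 s_{xy}` (the staggered current raised once more, `ε_x² = 1`) and
`[η†, s†_{xy}] = 0` (pair creators commute). S.-C. Zhang, PRL 65 (1990) 120; Yang–Zhang, Mod. Phys.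
Lett. B 4 (1990) 759, Theorem 1. [cite: YangZhang1990, Theorem 1] -/
theorem bond_etaTriplet (ε : Λ → ℤˣ) {x y : Λ} (hxy : ε x = -ε y) :
    etaLower ε * (etaLower ε *
          (creation (orb y 1) * creation (orb x 0) - creation (orb y 0) * creation (orb x 1)) -
        (creation (orb y 1) * creation (orb x 0) - creation (orb y 0) * creation (orb x 1)) *
          etaLower ε) -
      (etaLower ε *
          (creation (orb y 1) * creation (orb x 0) - creation (orb y 0) * creation (orb x 1)) -
        (creation (orb y 1) * creation (orb x 0) - creation (orb y 0) * creation (orb x 1)) *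
          etaLower ε) * etaLower ε =
      (2 : ℂ) • (annihilation (orb x 0) * annihilation (orb y 1) -
        annihilation (orb x 1) * annihilation (orb y 0)) ∧
    etaRaise ε * (creation (orb y 1) * creation (orb x 0) - creation (orb y 0) * creation (orb x 1)) -
      (creation (orb y 1) * creation (orb x 0) - creation (orb y 0) * creation (orb x 1)) *
        etaRaise ε = 0 := by
  constructor
  · have hsq : ((ε x : ℤ) : ℂ) * ((ε x : ℤ) : ℂ) = 1 := by
      rw [← Int.cast_mul, ← Units.val_mul, Int.units_mul_self, Units.val_one, Int.cast_one]
    rw [etaLower_commutator_bondCreation ε hxy, Matrix.mul_smul, Matrix.smul_mul, ← smul_sub,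
      etaLower_commutator_seamPair ε hxy (-1) 1, smul_smul]
    congr 1
    linear_combination (2 : ℂ) * hsq
  · rw [etaRaise, Finset.sum_mul, Finset.mul_sum, ← Finset.sum_sub_distrib]
    refine Finset.sum_eq_zero fun z _ => ?_
    rw [smul_mul_assoc, mul_smul_comm, ← smul_sub, mul_sub, sub_mul,
      ← crePair_mul_crePair_comm (orb y 1) (orb x 0) (orb z 0) (orb z 1),
      ← crePair_mul_crePair_comm (orb y 0) (orb x 1) (orb z 0) (orb z 1), sub_self, smul_zero]

end Bond

/-! ### Linear extension: real combinations of bipartite bond singlets -/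

section Linear

variable {m : Type*} [Fintype m] {κ : Type*}

/-- The double commutator `A ↦ [η, [η, A]]` is additive over finite sums. [folklore] -/
theorem doubleCommutator_finsetSum (η : Matrix m m ℂ) (s : Finset κ) (A : κ → Matrix m m ℂ) :
    η * (η * (∑ k ∈ s, A k) - (∑ k ∈ s, A k) * η) - (η * (∑ k ∈ s, A k) - (∑ k ∈ s, A k) * η) * η =
      ∑ k ∈ s, (η * (η * A k - A k * η) - (η * A k - A k * η) * η) := by
  simp only [Finset.mul_sum, Finset.sum_mul, ← Finset.sum_sub_distrib]

/-- The double commutator `A ↦ [η, [η, A]]` commutes with scalars. [folklore] -/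
theorem doubleCommutator_smul (η A : Matrix m m ℂ) (c : ℂ) :
    η * (η * (c • A) - (c • A) * η) - (η * (c • A) - (c • A) * η) * η =
      c • (η * (η * A - A * η) - (η * A - A * η) * η) := by
  simp only [Matrix.mul_smul, Matrix.smul_mul, ← smul_sub]

/-- The commutator `A ↦ [η, A]` is additive over finite sums. [folklore] -/
theorem singleCommutator_finsetSum (η : Matrix m m ℂ) (s : Finset κ) (A : κ → Matrix m m ℂ) :
    η * (∑ k ∈ s, A k) - (∑ k ∈ s, A k) * η = ∑ k ∈ s, (η * A k - A k * η) := by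
  rw [Finset.mul_sum, Finset.sum_mul, ← Finset.sum_sub_distrib]

/-- The commutator `A ↦ [η, A]` commutes with scalars. [folklore] -/
theorem singleCommutator_smul (η A : Matrix m m ℂ) (c : ℂ) :
    η * (c • A) - (c • A) * η = c • (η * A - A * η) := by
  rw [Matrix.mul_smul, Matrix.smul_mul, smul_sub]

end Linear

section BondSum

variable {Λ : Type*} [LinearOrder Λ] [Fintype Λ]

/-- **Real combinations of bipartite bond singlets are tops of `η`-triplets.** If
`P = Σ_{k ∈ s} w_k (c_{x_k↑}c_{y_k↓} - c_{x_k↓}c_{y_k↑})` with real weights `w_k` and `ε_{x_k} = -ε_{y_k}`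
for every `k ∈ s`, then `[η, [η, P†]] = 2P` and `[η†, P†] = 0` (`bond_etaTriplet` term by term; the
weights are self-conjugate). S.-C. Zhang, PRL 65 (1990) 120. [cite: YangZhang1990, Theorem 1] -/
theorem bondSum_etaTriplet (ε : Λ → ℤˣ) {κ : Type*} (s : Finset κ) (x y : κ → Λ) (w : κ → ℝ)
    (hε : ∀ k ∈ s, ε (x k) = -ε (y k)) (P : Matrix (Finset (Orb Λ)) (Finset (Orb Λ)) ℂ)
    (hP : P = ∑ k ∈ s, ((w k : ℝ) : ℂ) • (annihilation (orb (x k) 0) * annihilation (orb (y k) 1) -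
      annihilation (orb (x k) 1) * annihilation (orb (y k) 0))) :
    etaLower ε * (etaLower ε * Pᴴ - Pᴴ * etaLower ε) -
          (etaLower ε * Pᴴ - Pᴴ * etaLower ε) * etaLower ε = (2 : ℂ) • P ∧
      etaRaise ε * Pᴴ - Pᴴ * etaRaise ε = 0 := by
  subst hP
  have hst : ∀ k, ((((w k : ℝ) : ℂ)) • (annihilation (orb (x k) 0) * annihilation (orb (y k) 1) -
      annihilation (orb (x k) 1) * annihilation (orb (y k) 0)))ᴴ =
      ((w k : ℝ) : ℂ) • (creation (orb (y k) 1) * creation (orb (x k) 0) -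
        creation (orb (y k) 0) * creation (orb (x k) 1)) := by
    intro k
    simp only [conjTranspose_smul, conjTranspose_sub, conjTranspose_mul, annihilation_conjTranspose,
      Complex.star_def, Complex.conj_ofReal]
  constructor
  · rw [conjTranspose_sum, doubleCommutator_finsetSum, Finset.smul_sum]
    refine Finset.sum_congr rfl fun k hk => ?_
    rw [hst, doubleCommutator_smul, (bond_etaTriplet ε (hε k hk)).1, smul_comm]
  · rw [conjTranspose_sum, singleCommutator_finsetSum]
    refine Finset.sum_eq_zero fun k hk => ?_
    rw [hst, singleCommutator_smul, (bond_etaTriplet ε (hε k hk)).2, smul_zero]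

end BondSum

/-! ### The even tube: the `d_{x²-y²}` pair field and its column sums -/

section Tube

variable (L M : ℕ) (Λ : Type) [LinearOrder Λ] [Fintype Λ] (e : Λ ≃ ZMod L × ZMod M)

omit [LinearOrder Λ] [Fintype Λ] in
/-- **The four neighbours have the opposite stagger** (`L`, `M` even): the explicit sign
`(-1)^{a+b}` (as `if (a + b) % 2 = 0 then 1 else -1`, representatives in `[0,L) × [0,M)`) flips from
`x` to each of `x ± e₁`, `x ± e₂`, also across the wrap-around (`val_add_one_mod_two`); for `L = 2`
or `M = 2` the two neighbours in that direction coincide, harmlessly. Essler et al. (2005) §2.2.5.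
[cite: EsslerEtAl2005, §2.2.5] -/
theorem stagger_nbr_flip [NeZero L] [NeZero M] (hL : Even L) (hM : Even M) (x : Λ) (j : Fin 4) :
    (fun z : Λ => if ((e z).1.val + (e z).2.val) % 2 = 0 then (1 : ℤˣ) else -1) x =
      -(fun z : Λ => if ((e z).1.val + (e z).2.val) % 2 = 0 then (1 : ℤˣ) else -1)
        ((![e.symm ((e x).1 + 1, (e x).2), e.symm ((e x).1 - 1, (e x).2),
            e.symm ((e x).1, (e x).2 + 1), e.symm ((e x).1, (e x).2 - 1)] : Fin 4 → Λ) j) := by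
  have h1 := val_add_one_mod_two hL (e x).1
  have h2 := val_add_one_mod_two hL ((e x).1 - 1)
  have h3 := val_add_one_mod_two hM (e x).2
  have h4 := val_add_one_mod_two hM ((e x).2 - 1)
  rw [sub_add_cancel] at h2 h4
  have key : ∀ y : Λ, ((e y).1.val + (e y).2.val) % 2 = ((e x).1.val + (e x).2.val + 1) % 2 →
      (fun z : Λ => if ((e z).1.val + (e z).2.val) % 2 = 0 then (1 : ℤˣ) else -1) x =
        -(fun z : Λ => if ((e z).1.val + (e z).2.val) % 2 = 0 then (1 : ℤˣ) else -1) y := by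
    intro y hy
    dsimp only
    by_cases hx : ((e x).1.val + (e x).2.val) % 2 = 0
    · have hy' : ¬ ((e y).1.val + (e y).2.val) % 2 = 0 := by omega
      rw [if_pos hx, if_neg hy', neg_neg]
    · have hy' : ((e y).1.val + (e y).2.val) % 2 = 0 := by omega
      rw [if_neg hx, if_pos hy']
  refine key _ ?_
  fin_cases j <;>
    simp only [Fin.zero_eta, Fin.mk_one, Fin.reduceFinMk, Fin.isValue, Matrix.cons_val_zero,
      Matrix.cons_val_one, Matrix.cons_val, Equiv.apply_symm_apply] <;>
    omega

/-- **The `d_{x²-y²}` pair field is the top of an `η`-triplet**: if the stagger flips from `x` to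
each of its four neighbours, then `[η, [η, P_x†]] = 2 P_x` and `[η†, P_x†] = 0` for
`P_x = tubeDWavePair L M Λ e x = Σ_j (w_j/√2) s_{x, n_j}` (real weights). S.-C. Zhang, PRL 65 (1990)
120; Scalapino, Phys. Rep. 250 (1995) 329, §2. [cite: Scalapino1995, §2 eq. (2.4)] -/
theorem tubeDWavePair_etaTriplet (ε : Λ → ℤˣ) (x : Λ)
    (hε : ∀ j : Fin 4, ε x = -ε ((![e.symm ((e x).1 + 1, (e x).2), e.symm ((e x).1 - 1, (e x).2),
      e.symm ((e x).1, (e x).2 + 1), e.symm ((e x).1, (e x).2 - 1)] : Fin 4 → Λ) j)) :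
    etaLower ε * (etaLower ε * (tubeDWavePair L M Λ e x)ᴴ - (tubeDWavePair L M Λ e x)ᴴ * etaLower ε) -
        (etaLower ε * (tubeDWavePair L M Λ e x)ᴴ - (tubeDWavePair L M Λ e x)ᴴ * etaLower ε) *
          etaLower ε = (2 : ℂ) • tubeDWavePair L M Λ e x ∧
      etaRaise ε * (tubeDWavePair L M Λ e x)ᴴ - (tubeDWavePair L M Λ e x)ᴴ * etaRaise ε = 0 :=
  bondSum_etaTriplet ε Finset.univ (fun _ => x)
    (![e.symm ((e x).1 + 1, (e x).2), e.symm ((e x).1 - 1, (e x).2),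
      e.symm ((e x).1, (e x).2 + 1), e.symm ((e x).1, (e x).2 - 1)] : Fin 4 → Λ)
    (fun j => (![1, 1, -1, -1] : Fin 4 → ℝ) j / Real.sqrt 2) (fun j _ => hε j) _ rfl

end Tube

/-- **STUB `stub_columnPairTriplet` of line `IdeaSketchK2` of crux `WidthHaldaneBridge`
(stmt-HubbardSuperconductivity-16311): THE COLUMN PAIR FIELD IS THE TOP OF A PSEUDOSPIN TRIPLET.**
For `L`, `M` even, every labelling `e`, the explicit bipartite stagger `ε = (-1)^{a+b}` and every
column `a`, the column `d_{x²-y²}` pair field `Φ_a = Σ_b P_{e⁻¹(a,b)}` satisfies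
`[η_ε, [η_ε, Φ_a†]] = 2 Φ_a` and `[η_ε†, Φ_a†] = 0` (`η_ε = etaLower ε`, `η_ε† = etaRaise ε`): sum
`tubeDWavePair_etaTriplet` over the column, the neighbours' stagger flipping by `stagger_nbr_flip`.
S.-C. Zhang, PRL 65 (1990) 120; Yang–Zhang (1990) Theorem 1. [cite: YangZhang1990, Theorem 1] -/
theorem stub_columnPairTriplet :
    ∀ (L M : ℕ) [NeZero L] [NeZero M], Even L → Even M →
      ∀ (Λ : Type) [LinearOrder Λ] [Fintype Λ] (e : Λ ≃ ZMod L × ZMod M) (a : ZMod L),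
        etaLower (fun x => if ((e x).1.val + (e x).2.val) % 2 = 0 then (1 : ℤˣ) else -1) *
              (etaLower (fun x => if ((e x).1.val + (e x).2.val) % 2 = 0 then (1 : ℤˣ) else -1) *
                  (∑ b : ZMod M, tubeDWavePair L M Λ e (e.symm (a, b)))ᴴ -
                (∑ b : ZMod M, tubeDWavePair L M Λ e (e.symm (a, b)))ᴴ *
                  etaLower (fun x => if ((e x).1.val + (e x).2.val) % 2 = 0 then (1 : ℤˣ) else -1)) -
            (etaLower (fun x => if ((e x).1.val + (e x).2.val) % 2 = 0 then (1 : ℤˣ) else -1) *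
                  (∑ b : ZMod M, tubeDWavePair L M Λ e (e.symm (a, b)))ᴴ -
                (∑ b : ZMod M, tubeDWavePair L M Λ e (e.symm (a, b)))ᴴ *
                  etaLower (fun x => if ((e x).1.val + (e x).2.val) % 2 = 0 then (1 : ℤˣ) else -1)) *
              etaLower (fun x => if ((e x).1.val + (e x).2.val) % 2 = 0 then (1 : ℤˣ) else -1) =
          (2 : ℂ) • ∑ b : ZMod M, tubeDWavePair L M Λ e (e.symm (a, b)) ∧
        etaRaise (fun x => if ((e x).1.val + (e x).2.val) % 2 = 0 then (1 : ℤˣ) else -1) *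
              (∑ b : ZMod M, tubeDWavePair L M Λ e (e.symm (a, b)))ᴴ -
            (∑ b : ZMod M, tubeDWavePair L M Λ e (e.symm (a, b)))ᴴ *
              etaRaise (fun x => if ((e x).1.val + (e x).2.val) % 2 = 0 then (1 : ℤˣ) else -1) = 0 := by
  intro L M _ _ hL hM Λ _ _ e a
  have hP := fun b : ZMod M =>
    tubeDWavePair_etaTriplet L M Λ e
      (fun z : Λ => if ((e z).1.val + (e z).2.val) % 2 = 0 then (1 : ℤˣ) else -1) (e.symm (a, b))
      (stagger_nbr_flip L M Λ e hL hM (e.symm (a, b)))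
  constructor
  · rw [conjTranspose_sum, doubleCommutator_finsetSum, Finset.smul_sum]
    exact Finset.sum_congr rfl fun b _ => (hP b).1
  · rw [conjTranspose_sum, singleCommutator_finsetSum]
    exact Finset.sum_eq_zero fun b _ => (hP b).2

end Summit.HubbardSuperconductivity.HubbardSuperconductivity.Theorems.WidthHaldane

end
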